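import Mathlib
import Summits.Ventures.PercRepro2.HCov
import Summits.Ventures.PercRepro2.HCovCubic
import Summits.Ventures.PercRepro2.TriDisagreement
import Summits.Ventures.PercRepro2.TriDisagreementPinned
import Summits.Ventures.PercRepro2.TypedSplit
import Summits.Ventures.PercRepro2.OneTypedEdge
import Summits.Ventures.PercRepro2.StarPattern
import Summits.Ventures.PercRepro2.StarIdentities
import Summits.Ventures.PercRepro2.StarDebt
import Summits.Ventures.PercRepro2.ChainCoeff

/-!
# The out-of-cone stars in the chain basis: chain leaves plus two antichain leaves (blind cell
PercRepro2, p1 g11; LEAD-CCW (c⁗⁗⁗) «multi-state elements», CONJECTURES row 2′TRI-CH)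

In the multinomial chain basis of `ChainCoeff` the `(2,1,2)` star decomposes as

`N_(2,1,2) = 2·C(∅ ⊂ T; 2,1) + C(∅ ⊂ 02 ⊂ T; 1,1,1) + C(∅ ⊂ 02; 1,2) + A(01, 02) + A(02, 12)`

(**`star_212_chain`**; `A(P, Q)` = `Bthree P Q ∅` = the blocks `P`, `Q` in two distinct copies,
six orderings — an ANTICHAIN leaf, `P`, `Q` not nested), and symmetrically `N_(1,2,2)`
(**`star_122_chain`**). So under row 2′TRI-CH (`TriCH`: every chain coefficient `≥ 0`) the hard
step at these stars is EXACTLY the two antichain leaves: `N ≥ A(01, 02) + A(02, 12)`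
(**`typedCount_212_ge_anti_of_triCH`**, **`typedCount_122_ge_anti_of_triCH`**) — the chain
condition is the sign boundary, and what remains is the non-nested pair with the shared root.
-/

namespace Summit.Ventures.PercRepro2

open CovForm CovForm.OneTyped CovForm.TypedRed

namespace StarPattern

section ChainForm

variable {V : Type*} {E : Type*} [Fintype E] [DecidableEq E] {R : Type*} [Field R]
  {ends : E → Sym2 V} {o a₁ a₂ a₃ b : V} {s₁ s₂ s₃ : E} {y u₁ u₂ u₃ : V}

/-- **The `(2,1,2)` star in the chain basis**: three chain leaves and two antichain leaves. -/
theorem star_212_chain (F : Finset E) (z : Config E) (τ : E → ℕ)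
    (D : StarData ends o a₁ a₂ a₃ b s₁ s₂ s₃ y u₁ u₂ u₃ (((F.erase s₁).erase s₂).erase s₃)
      (Function.update (Function.update (Function.update z s₁ false) s₂ false) s₃ false))
    (hs₁ : s₁ ∈ F) (hs₂ : s₂ ∈ F) (hs₃ : s₃ ∈ F) (hτ₁ : τ s₁ = 2) (hτ₂ : τ s₂ = 1)
    (hτ₃ : τ s₃ = 2) :
    typedCount F z τ (K3 ends o a₁ a₂ a₃ b : Config E → Config E → Config E → R) =
      2 * chainCoeff ends o a₁ a₂ a₃ b s₁ s₂ s₃ (((F.erase s₁).erase s₂).erase s₃)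
        (Function.update (Function.update (Function.update z s₁ false) s₂ false) s₃ false) τ
        ![(false, false, false), (true, true, true)] ![2, 1] +
      chainCoeff ends o a₁ a₂ a₃ b s₁ s₂ s₃ (((F.erase s₁).erase s₂).erase s₃)
        (Function.update (Function.update (Function.update z s₁ false) s₂ false) s₃ false) τ
        ![(false, false, false), (true, false, true), (true, true, true)] ![1, 1, 1] +
      chainCoeff ends o a₁ a₂ a₃ b s₁ s₂ s₃ (((F.erase s₁).erase s₂).erase s₃)
        (Function.update (Function.update (Function.update z s₁ false) s₂ false) s₃ false) τ
        ![(false, false, false), (true, false, true)] ![1, 2] +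
      Bthree ends o a₁ a₂ a₃ b s₁ s₂ s₃ (((F.erase s₁).erase s₂).erase s₃)
        (Function.update (Function.update (Function.update z s₁ false) s₂ false) s₃ false) τ
        (true, true, false) (true, false, true) (false, false, false) +
      Bthree ends o a₁ a₂ a₃ b s₁ s₂ s₃ (((F.erase s₁).erase s₂).erase s₃)
        (Function.update (Function.update (Function.update z s₁ false) s₂ false) s₃ false) τ
        (true, false, true) (false, true, true) (false, false, false) := by
  rw [(typedCount_star_split_out ends o a₁ a₂ a₃ b D.h12 D.h13 D.h23 F hs₁ hs₂ hs₃ z τ).1 hτ₁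
    hτ₂ hτ₃]
  simp only [sum_placements, sum_placements2]
  simp only [patCount_close_x D τ (Or.inl rfl), patCount_close_x D τ (Or.inr (Or.inl rfl)),
    patCount_close_x D τ (Or.inr (Or.inr rfl)), patCount_close_y D τ _ (Or.inl rfl),
    patCount_close_y D τ _ (Or.inr (Or.inl rfl)), patCount_close_y D τ _ (Or.inr (Or.inr rfl)),
    patCount_close_w D τ _ _ (Or.inl rfl), patCount_close_w D τ _ _ (Or.inr (Or.inl rfl)),
    patCount_close_w D τ _ _ (Or.inr (Or.inr rfl))]
  rw [chainCoeff_two_one, chainCoeff_one_one_one, chainCoeff_one_two]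
  unfold Bthree
  ring

/-- **The `(1,2,2)` star in the chain basis.** -/
theorem star_122_chain (F : Finset E) (z : Config E) (τ : E → ℕ)
    (D : StarData ends o a₁ a₂ a₃ b s₁ s₂ s₃ y u₁ u₂ u₃ (((F.erase s₁).erase s₂).erase s₃)
      (Function.update (Function.update (Function.update z s₁ false) s₂ false) s₃ false))
    (hs₁ : s₁ ∈ F) (hs₂ : s₂ ∈ F) (hs₃ : s₃ ∈ F) (hτ₁ : τ s₁ = 1) (hτ₂ : τ s₂ = 2)
    (hτ₃ : τ s₃ = 2) :
    typedCount F z τ (K3 ends o a₁ a₂ a₃ b : Config E → Config E → Config E → R) =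
      2 * chainCoeff ends o a₁ a₂ a₃ b s₁ s₂ s₃ (((F.erase s₁).erase s₂).erase s₃)
        (Function.update (Function.update (Function.update z s₁ false) s₂ false) s₃ false) τ
        ![(false, false, false), (true, true, true)] ![2, 1] +
      chainCoeff ends o a₁ a₂ a₃ b s₁ s₂ s₃ (((F.erase s₁).erase s₂).erase s₃)
        (Function.update (Function.update (Function.update z s₁ false) s₂ false) s₃ false) τ
        ![(false, false, false), (false, true, true), (true, true, true)] ![1, 1, 1] +
      chainCoeff ends o a₁ a₂ a₃ b s₁ s₂ s₃ (((F.erase s₁).erase s₂).erase s₃)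
        (Function.update (Function.update (Function.update z s₁ false) s₂ false) s₃ false) τ
        ![(false, false, false), (false, true, true)] ![1, 2] +
      Bthree ends o a₁ a₂ a₃ b s₁ s₂ s₃ (((F.erase s₁).erase s₂).erase s₃)
        (Function.update (Function.update (Function.update z s₁ false) s₂ false) s₃ false) τ
        (true, true, false) (false, true, true) (false, false, false) +
      Bthree ends o a₁ a₂ a₃ b s₁ s₂ s₃ (((F.erase s₁).erase s₂).erase s₃)
        (Function.update (Function.update (Function.update z s₁ false) s₂ false) s₃ false) τ
        (true, false, true) (false, true, true) (false, false, false) := by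
  rw [(typedCount_star_split_out ends o a₁ a₂ a₃ b D.h12 D.h13 D.h23 F hs₁ hs₂ hs₃ z τ).2 hτ₁
    hτ₂ hτ₃]
  simp only [sum_placements, sum_placements2]
  simp only [patCount_close_x D τ (Or.inl rfl), patCount_close_x D τ (Or.inr (Or.inl rfl)),
    patCount_close_x D τ (Or.inr (Or.inr rfl)), patCount_close_y D τ _ (Or.inl rfl),
    patCount_close_y D τ _ (Or.inr (Or.inl rfl)), patCount_close_y D τ _ (Or.inr (Or.inr rfl)),
    patCount_close_w D τ _ _ (Or.inl rfl), patCount_close_w D τ _ _ (Or.inr (Or.inl rfl)),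
    patCount_close_w D τ _ _ (Or.inr (Or.inr rfl))]
  rw [chainCoeff_two_one, chainCoeff_one_one_one, chainCoeff_one_two]
  unfold Bthree
  ring

/-- **The `(2,2,2)` star in the chain basis**: four chain leaves and the antichain triple. -/
theorem star_222_chain (F : Finset E) (z : Config E) (τ : E → ℕ)
    (D : StarData ends o a₁ a₂ a₃ b s₁ s₂ s₃ y u₁ u₂ u₃ (((F.erase s₁).erase s₂).erase s₃)
      (Function.update (Function.update (Function.update z s₁ false) s₂ false) s₃ false))
    (hs₁ : s₁ ∈ F) (hs₂ : s₂ ∈ F) (hs₃ : s₃ ∈ F) (hτ₁ : τ s₁ = 2) (hτ₂ : τ s₂ = 2)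
    (hτ₃ : τ s₃ = 2) :
    typedCount F z τ (K3 ends o a₁ a₂ a₃ b : Config E → Config E → Config E → R) =
      chainCoeff ends o a₁ a₂ a₃ b s₁ s₂ s₃ (((F.erase s₁).erase s₂).erase s₃)
        (Function.update (Function.update (Function.update z s₁ false) s₂ false) s₃ false) τ
        ![(false, false, false), (true, true, false), (true, true, true)] ![1, 1, 1] +
      chainCoeff ends o a₁ a₂ a₃ b s₁ s₂ s₃ (((F.erase s₁).erase s₂).erase s₃)
        (Function.update (Function.update (Function.update z s₁ false) s₂ false) s₃ false) τ
        ![(false, false, false), (true, false, true), (true, true, true)] ![1, 1, 1] +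
      chainCoeff ends o a₁ a₂ a₃ b s₁ s₂ s₃ (((F.erase s₁).erase s₂).erase s₃)
        (Function.update (Function.update (Function.update z s₁ false) s₂ false) s₃ false) τ
        ![(false, false, false), (false, true, true), (true, true, true)] ![1, 1, 1] +
      chainCoeff ends o a₁ a₂ a₃ b s₁ s₂ s₃ (((F.erase s₁).erase s₂).erase s₃)
        (Function.update (Function.update (Function.update z s₁ false) s₂ false) s₃ false) τ
        ![(false, false, false), (true, true, true)] ![1, 2] +
      Bthree ends o a₁ a₂ a₃ b s₁ s₂ s₃ (((F.erase s₁).erase s₂).erase s₃)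
        (Function.update (Function.update (Function.update z s₁ false) s₂ false) s₃ false) τ
        (true, true, false) (true, false, true) (false, true, true) := by
  rw [typedCount_star_split_222 ends o a₁ a₂ a₃ b D.h12 D.h13 D.h23 F hs₁ hs₂ hs₃ z τ hτ₁ hτ₂ hτ₃]
  simp only [sum_placements2]
  simp only [patCount_close_x D τ (Or.inl rfl), patCount_close_x D τ (Or.inr (Or.inl rfl)),
    patCount_close_x D τ (Or.inr (Or.inr rfl)), patCount_close_y D τ _ (Or.inl rfl),
    patCount_close_y D τ _ (Or.inr (Or.inl rfl)), patCount_close_y D τ _ (Or.inr (Or.inr rfl)),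
    patCount_close_w D τ _ _ (Or.inl rfl), patCount_close_w D τ _ _ (Or.inr (Or.inl rfl)),
    patCount_close_w D τ _ _ (Or.inr (Or.inr rfl))]
  rw [chainCoeff_one_one_one, chainCoeff_one_one_one, chainCoeff_one_one_one, chainCoeff_one_two]
  unfold Bthree
  ring

end ChainForm

section Consequence

variable {V : Type*} {E : Type*} [Fintype E] [DecidableEq E] {R : Type*} [Field R] [LinearOrder R]
  [IsStrictOrderedRing R] {ends : E → Sym2 V} {o a₁ a₂ a₃ b : V} {s₁ s₂ s₃ : E} {y u₁ u₂ u₃ : V}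

/-- `∅ ⊂ T` is a chain. -/
lemma isChain_T : IsChain ![(false, false, false), (true, true, true)] := by
  unfold IsChain patLE; decide

/-- `∅ ⊂ 02 ⊂ T` is a chain. -/
lemma isChain_02_T :
    IsChain ![(false, false, false), (true, false, true), (true, true, true)] := by
  unfold IsChain patLE; decide

/-- `∅ ⊂ 02` is a chain. -/
lemma isChain_02 : IsChain ![(false, false, false), (true, false, true)] := by
  unfold IsChain patLE; decide

/-- `∅ ⊂ 12 ⊂ T` is a chain. -/
lemma isChain_12_T :
    IsChain ![(false, false, false), (false, true, true), (true, true, true)] := by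
  unfold IsChain patLE; decide

/-- `∅ ⊂ 12` is a chain. -/
lemma isChain_12 : IsChain ![(false, false, false), (false, true, true)] := by
  unfold IsChain patLE; decide

/-- **Under 2′TRI-CH the `(2,1,2)` hard step is the two antichain leaves**:
`N_(2,1,2) ≥ A(01, 02) + A(02, 12)`. -/
theorem typedCount_212_ge_anti_of_triCH (F : Finset E) (z : Config E) (τ : E → ℕ)
    (D : StarData ends o a₁ a₂ a₃ b s₁ s₂ s₃ y u₁ u₂ u₃ (((F.erase s₁).erase s₂).erase s₃)
      (Function.update (Function.update (Function.update z s₁ false) s₂ false) s₃ false))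
    (hs₁ : s₁ ∈ F) (hs₂ : s₂ ∈ F) (hs₃ : s₃ ∈ F) (hτ₁ : τ s₁ = 2) (hτ₂ : τ s₂ = 1)
    (hτ₃ : τ s₃ = 2)
    (hCH : TriCH (R := R) ends o a₁ a₂ a₃ b s₁ s₂ s₃ (((F.erase s₁).erase s₂).erase s₃)
      (Function.update (Function.update (Function.update z s₁ false) s₂ false) s₃ false) τ) :
    Bthree ends o a₁ a₂ a₃ b s₁ s₂ s₃ (((F.erase s₁).erase s₂).erase s₃)
        (Function.update (Function.update (Function.update z s₁ false) s₂ false) s₃ false) τ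
        (true, true, false) (true, false, true) (false, false, false) +
      Bthree ends o a₁ a₂ a₃ b s₁ s₂ s₃ (((F.erase s₁).erase s₂).erase s₃)
        (Function.update (Function.update (Function.update z s₁ false) s₂ false) s₃ false) τ
        (true, false, true) (false, true, true) (false, false, false) ≤
      typedCount F z τ (K3 ends o a₁ a₂ a₃ b : Config E → Config E → Config E → R) := by
  rw [star_212_chain F z τ D hs₁ hs₂ hs₃ hτ₁ hτ₂ hτ₃]
  have h1 := hCH 1 _ isChain_T ![2, 1] (by decide)
  have h2 := hCH 2 _ isChain_02_T ![1, 1, 1] (by decide)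
  have h3 := hCH 1 _ isChain_02 ![1, 2] (by decide)
  linarith

/-- **Under 2′TRI-CH the `(1,2,2)` hard step is the two antichain leaves.** -/
theorem typedCount_122_ge_anti_of_triCH (F : Finset E) (z : Config E) (τ : E → ℕ)
    (D : StarData ends o a₁ a₂ a₃ b s₁ s₂ s₃ y u₁ u₂ u₃ (((F.erase s₁).erase s₂).erase s₃)
      (Function.update (Function.update (Function.update z s₁ false) s₂ false) s₃ false))
    (hs₁ : s₁ ∈ F) (hs₂ : s₂ ∈ F) (hs₃ : s₃ ∈ F) (hτ₁ : τ s₁ = 1) (hτ₂ : τ s₂ = 2)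
    (hτ₃ : τ s₃ = 2)
    (hCH : TriCH (R := R) ends o a₁ a₂ a₃ b s₁ s₂ s₃ (((F.erase s₁).erase s₂).erase s₃)
      (Function.update (Function.update (Function.update z s₁ false) s₂ false) s₃ false) τ) :
    Bthree ends o a₁ a₂ a₃ b s₁ s₂ s₃ (((F.erase s₁).erase s₂).erase s₃)
        (Function.update (Function.update (Function.update z s₁ false) s₂ false) s₃ false) τ
        (true, true, false) (false, true, true) (false, false, false) +
      Bthree ends o a₁ a₂ a₃ b s₁ s₂ s₃ (((F.erase s₁).erase s₂).erase s₃)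
        (Function.update (Function.update (Function.update z s₁ false) s₂ false) s₃ false) τ
        (true, false, true) (false, true, true) (false, false, false) ≤
      typedCount F z τ (K3 ends o a₁ a₂ a₃ b : Config E → Config E → Config E → R) := by
  rw [star_122_chain F z τ D hs₁ hs₂ hs₃ hτ₁ hτ₂ hτ₃]
  have h1 := hCH 1 _ isChain_T ![2, 1] (by decide)
  have h2 := hCH 2 _ isChain_12_T ![1, 1, 1] (by decide)
  have h3 := hCH 1 _ isChain_12 ![1, 2] (by decide)
  linarith

/-- The unique assignment with counts `(3)` on the trivial chain `∅`. -/
lemma assignments_three : assignments (r := 0) ![3] = {![0, 0, 0]} := by decide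

omit [LinearOrder R] [IsStrictOrderedRing R] in
/-- The trivial chain `∅` gives the empty base. -/
theorem chainCoeff_three (ends : E → Sym2 V) (o a₁ a₂ a₃ b : V) (s₁ s₂ s₃ : E) (F₀ : Finset E)
    (z₀ : Config E) (τ : E → ℕ) :
    chainCoeff (R := R) ends o a₁ a₂ a₃ b s₁ s₂ s₃ F₀ z₀ τ ![(false, false, false)] ![3] =
      Bempty ends o a₁ a₂ a₃ b s₁ s₂ s₃ F₀ z₀ τ := by
  unfold chainCoeff Bempty
  rw [assignments_three, Finset.sum_singleton]
  simp only [Matrix.cons_val_zero, Matrix.cons_val_one, Matrix.head_cons, Matrix.cons_val_two,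
    Matrix.tail_cons]

/-- `∅` is a chain. -/
lemma isChain_empty : IsChain ![(false, false, false)] := by
  unfold IsChain patLE; decide

/-- `∅ ⊂ 01` is a chain. -/
lemma isChain_01 : IsChain ![(false, false, false), (true, true, false)] := by
  unfold IsChain patLE; decide

omit [LinearOrder R] [IsStrictOrderedRing R] in
/-- The one-block bases are chain coefficients. -/
theorem Bone_eq_chainCoeff (ends : E → Sym2 V) (o a₁ a₂ a₃ b : V) (s₁ s₂ s₃ : E) (F₀ : Finset E)
    (z₀ : Config E) (τ : E → ℕ) (P : Bool × Bool × Bool) :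
    Bone (R := R) ends o a₁ a₂ a₃ b s₁ s₂ s₃ F₀ z₀ τ P =
      chainCoeff ends o a₁ a₂ a₃ b s₁ s₂ s₃ F₀ z₀ τ ![(false, false, false), P] ![2, 1] := by
  rw [chainCoeff_two_one]; unfold Bone; ring

/-- **Under 2′TRI-CH the `(1,1,1)` star is free**: `0 ≤ N_(1,1,1)`. -/
theorem typedCount_111_nonneg_of_triCH (F : Finset E) (z : Config E) (τ : E → ℕ)
    (D : StarData ends o a₁ a₂ a₃ b s₁ s₂ s₃ y u₁ u₂ u₃ (((F.erase s₁).erase s₂).erase s₃)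
      (Function.update (Function.update (Function.update z s₁ false) s₂ false) s₃ false))
    (hs₁ : s₁ ∈ F) (hs₂ : s₂ ∈ F) (hs₃ : s₃ ∈ F) (hτ₁ : τ s₁ = 1) (hτ₂ : τ s₂ = 1)
    (hτ₃ : τ s₃ = 1)
    (hCH : TriCH (R := R) ends o a₁ a₂ a₃ b s₁ s₂ s₃ (((F.erase s₁).erase s₂).erase s₃)
      (Function.update (Function.update (Function.update z s₁ false) s₂ false) s₃ false) τ) :
    0 ≤ typedCount F z τ (K3 ends o a₁ a₂ a₃ b : Config E → Config E → Config E → R) := by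
  rw [star_111 F z τ D hs₁ hs₂ hs₃ hτ₁ hτ₂ hτ₃, ← chainCoeff_three, Bone_eq_chainCoeff,
    Bone_eq_chainCoeff, Bone_eq_chainCoeff, Bone_eq_chainCoeff]
  have h0 := hCH 0 _ isChain_empty ![3] (by decide)
  have h1 := hCH 1 _ isChain_01 ![2, 1] (by decide)
  have h2 := hCH 1 _ isChain_02 ![2, 1] (by decide)
  have h3 := hCH 1 _ isChain_12 ![2, 1] (by decide)
  have h4 := hCH 1 _ isChain_T ![2, 1] (by decide)
  linarith

/-- **Under 2′TRI-CH the `(2,1,1)` star is free modulo its type-`3` contraction**: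
`N_(3,1,1) ≤ N_(2,1,1)`. -/
theorem typedCount_211_ge_311_of_triCH (F : Finset E) (z : Config E) (τ : E → ℕ)
    (D : StarData ends o a₁ a₂ a₃ b s₁ s₂ s₃ y u₁ u₂ u₃ (((F.erase s₁).erase s₂).erase s₃)
      (Function.update (Function.update (Function.update z s₁ false) s₂ false) s₃ false))
    (hs₁ : s₁ ∈ F) (hs₂ : s₂ ∈ F) (hs₃ : s₃ ∈ F) (hτ₁ : τ s₁ = 2) (hτ₂ : τ s₂ = 1)
    (hτ₃ : τ s₃ = 1)
    (hCH : TriCH (R := R) ends o a₁ a₂ a₃ b s₁ s₂ s₃ (((F.erase s₁).erase s₂).erase s₃)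
      (Function.update (Function.update (Function.update z s₁ false) s₂ false) s₃ false) τ) :
    typedCount F z (Function.update τ s₁ 3) (K3 ends o a₁ a₂ a₃ b : Config E → Config E → Config E → R) ≤
      typedCount F z τ (K3 ends o a₁ a₂ a₃ b) := by
  rw [star_211 F z τ D hs₁ hs₂ hs₃ hτ₁ hτ₂ hτ₃, Bone_eq_chainCoeff, Bone_eq_chainCoeff,
    Bone_eq_chainCoeff, Bone_eq_chainCoeff]
  have h1 := hCH 1 _ isChain_01 ![2, 1] (by decide)
  have h2 := hCH 1 _ isChain_02 ![2, 1] (by decide)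
  have h3 := hCH 1 _ isChain_12 ![2, 1] (by decide)
  have h4 := hCH 1 _ isChain_T ![2, 1] (by decide)
  linarith

/-- **Under 2′TRI-CH the `(1,1,2)` star is free modulo its type-`3` contraction**:
`N_(1,1,3) ≤ N_(1,1,2)`. -/
theorem typedCount_112_ge_113_of_triCH (F : Finset E) (z : Config E) (τ : E → ℕ)
    (D : StarData ends o a₁ a₂ a₃ b s₁ s₂ s₃ y u₁ u₂ u₃ (((F.erase s₁).erase s₂).erase s₃)
      (Function.update (Function.update (Function.update z s₁ false) s₂ false) s₃ false))
    (hs₁ : s₁ ∈ F) (hs₂ : s₂ ∈ F) (hs₃ : s₃ ∈ F) (hτ₁ : τ s₁ = 1) (hτ₂ : τ s₂ = 1)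
    (hτ₃ : τ s₃ = 2)
    (hCH : TriCH (R := R) ends o a₁ a₂ a₃ b s₁ s₂ s₃ (((F.erase s₁).erase s₂).erase s₃)
      (Function.update (Function.update (Function.update z s₁ false) s₂ false) s₃ false) τ) :
    typedCount F z (Function.update τ s₃ 3) (K3 ends o a₁ a₂ a₃ b : Config E → Config E → Config E → R) ≤
      typedCount F z τ (K3 ends o a₁ a₂ a₃ b) := by
  rw [star_112 F z τ D hs₁ hs₂ hs₃ hτ₁ hτ₂ hτ₃, Bone_eq_chainCoeff, Bone_eq_chainCoeff,
    Bone_eq_chainCoeff, Bone_eq_chainCoeff]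
  have h1 := hCH 1 _ isChain_01 ![2, 1] (by decide)
  have h2 := hCH 1 _ isChain_02 ![2, 1] (by decide)
  have h3 := hCH 1 _ isChain_12 ![2, 1] (by decide)
  have h4 := hCH 1 _ isChain_T ![2, 1] (by decide)
  linarith

/-- `∅ ⊂ 01 ⊂ T` is a chain. -/
lemma isChain_01_T :
    IsChain ![(false, false, false), (true, true, false), (true, true, true)] := by
  unfold IsChain patLE; decide

/-- **Under 2′TRI-CH the `(2,2,2)` hard step is the antichain triple**: `A(01, 02, 12) ≤ N_(2,2,2)`. -/
theorem typedCount_222_ge_anti_of_triCH (F : Finset E) (z : Config E) (τ : E → ℕ)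
    (D : StarData ends o a₁ a₂ a₃ b s₁ s₂ s₃ y u₁ u₂ u₃ (((F.erase s₁).erase s₂).erase s₃)
      (Function.update (Function.update (Function.update z s₁ false) s₂ false) s₃ false))
    (hs₁ : s₁ ∈ F) (hs₂ : s₂ ∈ F) (hs₃ : s₃ ∈ F) (hτ₁ : τ s₁ = 2) (hτ₂ : τ s₂ = 2)
    (hτ₃ : τ s₃ = 2)
    (hCH : TriCH (R := R) ends o a₁ a₂ a₃ b s₁ s₂ s₃ (((F.erase s₁).erase s₂).erase s₃)
      (Function.update (Function.update (Function.update z s₁ false) s₂ false) s₃ false) τ) :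
    Bthree ends o a₁ a₂ a₃ b s₁ s₂ s₃ (((F.erase s₁).erase s₂).erase s₃)
        (Function.update (Function.update (Function.update z s₁ false) s₂ false) s₃ false) τ
        (true, true, false) (true, false, true) (false, true, true) ≤
      typedCount F z τ (K3 ends o a₁ a₂ a₃ b : Config E → Config E → Config E → R) := by
  rw [star_222_chain F z τ D hs₁ hs₂ hs₃ hτ₁ hτ₂ hτ₃]
  have h1 := hCH 2 _ isChain_01_T ![1, 1, 1] (by decide)
  have h2 := hCH 2 _ isChain_02_T ![1, 1, 1] (by decide)
  have h3 := hCH 2 _ isChain_12_T ![1, 1, 1] (by decide)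
  have h4 := hCH 1 _ isChain_T ![1, 2] (by decide)
  linarith

end Consequence

end StarPattern

end Summit.Ventures.PercRepro2
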